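import Literature.AnabelianGeometry.AbsoluteAnabelian.AbsTopII.BelyiCuspidalizationSchemaScope
import Literature.AnabelianGeometry.AbsoluteAnabelian.FreeProSigmaNonVacuity
import HarnessLib

/-!
# [AbsTopII] Cor 3.8 (and Cor 3.7) as typed over `BelyiCurveModel` — CLOSED INSTANCE FORMS at the
# split tripod-shaped model over `ℚ` with the identity cuspidalization (FACT-LIST rows F-0268, F-0267)

S. Mochizuki, *Topics in Absolute Anabelian Geometry II: Decomposition Groups and Endomorphisms*
[MochizukiAbsTopII2013] (manuscript pagination, lit key `paper:url-585b8d0ad0d9`), Corollary 3.8 p. 74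
(Profinite Belyi Cuspidalization II: Comparison — "for each nonempty open subscheme `U_{X₁} ⊆ X₁` defined
over a number field, there exist a nonempty open subscheme `U_{X₂} ⊆ X₂` [...] and an isomorphism
`φ_U : Π_{U_{X₁}} ≅ Π_{U_{X₂}}` that is compatible with `φ` [...] unique up to composition with an inner
automorphism arising from an element of the kernel of `Π_{U_{X_i}} ↠ Π_i`") and Corollary 3.7 pp. 72–73.
abc-iut-L4-t6 typed both as predicates `BelyiCurveModel.Cor_3_8 M` / `Cor_3_7 M` on a MODEL INTERFACE
(`AbsTopII/BelyiCuspidalization.lean`; shape (M), "no instance in the tree").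

PROOF-ONLY companion (theorems only: no `def`, no `instance`, no `structure`, no notation); abc-iut cell,
block F, seat abc-iut-f-057, KEY row INST59H1.  State of F-0268 in the LF kernel census #6: «∀-closure
REFUTED (schema)» (`BelyiCurveModel.not_forall_cor_3_8`, abc-iut-f-064) with ONE conditional closer,
`cor_3_8_of_isEmpty_open`, which is VACUOUS (no NF-open at all) — no instance-type theorem at data.
This file gives NON-VACUOUS closed instance forms at a model WRITTEN OUT AS A TERM:

**The split tripod-shaped model over `ℚ` with the identity cuspidalization.**  One curve; its extension
`Π = F̂₂ × G_ℚ ↠ G_ℚ` (second projection; `Δ = F̂₂ × 1`, `F̂₂` = the free profinite group on `x_0, x_1`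
= Mathlib's profinite completion of `F₂` — the SHAPE of the geometric fundamental group of the tripod
`ℙ¹ ∖ {0,1,∞}`), recorded as a genus-`0` scheme with `3` cusps defined over a number field (so of strictly
Belyi type, Def 3.5), base field `ℚ` with `G ≅ Gal(ℚ̄/ℚ)` the identity, its only finite étale morphism
the identity; ONE NF-rational open `U_X := X` itself, whose cuspidalization `Π_{U_X} ↠ Π` is the
IDENTITY of `Π`, carrying one recorded cusp `D = cl⟨η x_0⟩ × G_ℚ`.  Then:

* `isCor37Input_tripodIdModel` — EVERY hypothesis of Cor 3.7 / 3.8 HOLDS at the curve (non-vacuity of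
  the instances below): strictly Belyi type by the recorded invariants; `ℚ` is sub-`2`-adic hence
  generalized sub-`2`-adic ([pGC] Def 15.4 (i) ex. (2), [Tpcs] Rmk after Def 4.11); "`G` slim" and
  "`χ_l` has open image" are then the tree's kernel theorems (`isCor37Input_of_isGeneralizedSubpadicFor`,
  abc-iut-L4);
* `cor_3_8_tripodIdModel` — **F-0268, CLOSED INSTANCE FORM**: for every `φ : Π ≃ Π` with `φ(Δ) = Δ` and
  the open `U_X = X`, `φ_U := φ` is compatible with `φ` relative to the identity cuspidalizations, and any
  two compatible `φ_U, φ_U'` are EQUAL (the kernel of `Π_{U} ↠ Π` is trivial, `g := 1`);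
* `cor_3_7_tripodIdModel` — F-0267 at the same term: `Δ_{U_X} = Δ ≅ F̂₂` is slim
  (`isSlimGroup_profiniteCompletion_freeGroup`), so abc-iut-f-064's `cor_3_7_of_isSlimGroup_cuspOf_geom`
  fires.

HONEST LABEL: the only NF-open recorded is `X` itself (identity cuspidalization, trivial kernel) — the
Belyi CONTENT of Cor 3.7 / 3.8 (proper opens `U_X ⊊ X`, cusps to be reconstructed, lifting `φ` through a
non-trivial `Π_U ↠ Π`) is absent, and the split `Π` is NOT the étale `π₁` of the tripod over `ℚ` (whose
outer Galois action is faithful by Belyi; no étale `π₁` is constructed in the tree, abc-iut FOUNDATIONS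
row 12).  A joint-satisfiability / instance statement about OUR typed interface; instantiated ≠ endorsed;
typed ≠ proved; nothing here bears on [IUTchIII] Cor. 3.12 or takes a side.
-/

noncomputable section

open CategoryTheory

universe u

namespace Literature.AnabelianGeometry.AbsoluteAnabelian.AbsTopII.BelyiCurveModel

open Literature.IUT.HodgeTheaters (profiniteCompletion toCompletion)
open Literature.AlgebraicGeometry.Frobenioids (IsSlimGroup)

/-! ### A general form: models all of whose recorded NF-opens carry the identity cuspidalization -/

/-- **`Cor_3_8 M` for models whose recorded cuspidalizations are identities**: if every curve of `M` has
an NF-open and every `Π_{U_X} ↠ Π_X` of the model IS the identity of `Π_X`, then `Cor_3_8 M` holds —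
`U₂ :=` any open of `X₂`, `φ_U := φ`, and two lifts compatible with `φ` coincide (`g := 1`).  The
degenerate-but-honest mechanism behind `cor_3_8_tripodIdModel`. [cite: MochizukiAbsTopII2013, Cor 3.8 p.74] -/
theorem cor_3_8_of_cuspOf_eq_id (M : BelyiCurveModel.{u}) (hU : ∀ X : M.Curve, Nonempty (M.Open X))
    (hid : ∀ (X : M.Curve) (U : M.Open X),
      M.cuspOf U = ⟨M.ext X, 𝟙 (M.ext X), fun x => ⟨x, rfl⟩, Function.bijective_id⟩) :
    M.Cor_3_8 := by
  intro X₁ X₂ _ _ _ φ _ U₁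
  obtain ⟨U₂⟩ := hU X₂
  refine ⟨U₂, ?_⟩
  rw [hid X₁ U₁, hid X₂ U₂]
  refine ⟨⟨φ, fun _ => rfl⟩, fun φU φU' hφU hφU' => ⟨1, map_one _, fun x => ?_⟩⟩
  rw [one_mul, inv_one, mul_one]
  exact (hφU' x).trans (hφU x).symm

/-- **The hypotheses of [AbsTopII] Cor 3.7 / 3.8 HOLD at the split tripod-shaped model over `ℚ`**: its
curve is of strictly Belyi type (genus-`0` scheme defined over a number field, isogenous to itself), its
base field `ℚ` is generalized sub-`2`-adic, and "`G_ℚ` slim" / "`χ_2` open image" follow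
(`isCor37Input_of_isGeneralizedSubpadicFor`).  Non-vacuity witness for `cor_3_8_tripodIdModel`.
[cite: MochizukiAbsTopII2013, Rmk 3.7.1 p.73] -/
theorem isCor37Input_tripodIdModel :
    ∀ X, Literature.AnabelianGeometry.AbsoluteAnabelian.AbsTopII.BelyiCurveModel.IsCor37Input
      ({ Curve := Unit
         ext := fun _ =>
           { arith := ProfiniteGrp.of (profiniteCompletion (FreeGroup (Fin 2)) × Field.absoluteGaloisGroup ℚ)
             gal := absoluteGaloisGrp ℚ
             aug := ContinuousMonoidHom.snd _ _
             aug_surjective := fun y => ⟨(1, y), rfl⟩ }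
         FinEt := fun _ _ => Unit
         extMap := fun _ => 𝟙 _
         extMap_isOpenInjective := fun _ => FundamentalExtension.Hom.IsOpenInjective.id _
         IsScheme := fun _ => True
         genus := fun _ => 0
         cuspCard := fun _ => 3
         IsDefinedOverNF := fun _ => True
         base := fun _ => ℚ
         instField := fun _ => inferInstance
         instCharZero := fun _ => inferInstance
         galIso := fun _ => Iso.refl _
         Open := fun _ => Unit
         cuspOf := fun _ => ⟨_, 𝟙 _, Function.surjective_id, Function.bijective_id⟩
         cuspsOf := fun _ =>
           { Cusp := Unit
             Dcusp := fun _ =>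
               Subgroup.comap (MonoidHom.fst _ (Field.absoluteGaloisGroup ℚ))
                 (Subgroup.zpowers (toCompletion (FreeGroup (Fin 2)) (FreeGroup.of 0))).topologicalClosure
             Icusp := fun _ =>
               Subgroup.comap (MonoidHom.fst _ (Field.absoluteGaloisGroup ℚ))
                   (Subgroup.zpowers
                     (toCompletion (FreeGroup (Fin 2)) (FreeGroup.of 0))).topologicalClosure ⊓
                 (ContinuousMonoidHom.snd (profiniteCompletion (FreeGroup (Fin 2)))
                   (Field.absoluteGaloisGroup ℚ)).toMonoidHom.ker
             Icusp_eq := fun _ => rfl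
             isClosed_Dcusp := fun _ => (Subgroup.isClosed_topologicalClosure _).preimage continuous_fst
             eq_of_conj := fun _ _ _ _ => rfl } } : BelyiCurveModel.{0}) X := by
  intro X
  haveI : Fact (Nat.Prime 2) := ⟨Nat.prime_two⟩
  exact isCor37Input_of_isGeneralizedSubpadicFor _ ⟨trivial, X, trivial, rfl, X, ⟨()⟩, ⟨()⟩⟩
    ((AbsTopIII.IsSubpadicFor.of_numberField ℚ 2).isGeneralizedSubpadicFor)

/-- **F-0268, CLOSED INSTANCE FORM** ([AbsTopII] Cor 3.8 as typed, `Cor_3_8 M`) at the split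
tripod-shaped model over `ℚ` with the identity cuspidalization: for all curves `X₁, X₂` (there is one)
satisfying the hypotheses (they do: `isCor37Input_tripodIdModel`), every common prime `l` with `χ_l`
open, every `φ : Π ≃ Π` with `φ(Δ) = Δ` and every NF-open `U₁` (`= X`), the open `U₂ := X` and
`φ_U := φ` are compatible with `φ` relative to the (identity) cuspidalizations, and compatible lifts are
unique on the nose (`g = 1`).  NON-VACUOUS but with the Belyi content absent (see the module docstring).
[cite: MochizukiAbsTopII2013, Cor 3.8 p.74] -/
theorem cor_3_8_tripodIdModel :
    Literature.AnabelianGeometry.AbsoluteAnabelian.AbsTopII.BelyiCurveModel.Cor_3_8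
      ({ Curve := Unit
         ext := fun _ =>
           { arith := ProfiniteGrp.of (profiniteCompletion (FreeGroup (Fin 2)) × Field.absoluteGaloisGroup ℚ)
             gal := absoluteGaloisGrp ℚ
             aug := ContinuousMonoidHom.snd _ _
             aug_surjective := fun y => ⟨(1, y), rfl⟩ }
         FinEt := fun _ _ => Unit
         extMap := fun _ => 𝟙 _
         extMap_isOpenInjective := fun _ => FundamentalExtension.Hom.IsOpenInjective.id _
         IsScheme := fun _ => True
         genus := fun _ => 0
         cuspCard := fun _ => 3
         IsDefinedOverNF := fun _ => True
         base := fun _ => ℚ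
         instField := fun _ => inferInstance
         instCharZero := fun _ => inferInstance
         galIso := fun _ => Iso.refl _
         Open := fun _ => Unit
         cuspOf := fun _ => ⟨_, 𝟙 _, Function.surjective_id, Function.bijective_id⟩
         cuspsOf := fun _ =>
           { Cusp := Unit
             Dcusp := fun _ =>
               Subgroup.comap (MonoidHom.fst _ (Field.absoluteGaloisGroup ℚ))
                 (Subgroup.zpowers (toCompletion (FreeGroup (Fin 2)) (FreeGroup.of 0))).topologicalClosure
             Icusp := fun _ =>
               Subgroup.comap (MonoidHom.fst _ (Field.absoluteGaloisGroup ℚ))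
                   (Subgroup.zpowers
                     (toCompletion (FreeGroup (Fin 2)) (FreeGroup.of 0))).topologicalClosure ⊓
                 (ContinuousMonoidHom.snd (profiniteCompletion (FreeGroup (Fin 2)))
                   (Field.absoluteGaloisGroup ℚ)).toMonoidHom.ker
             Icusp_eq := fun _ => rfl
             isClosed_Dcusp := fun _ => (Subgroup.isClosed_topologicalClosure _).preimage continuous_fst
             eq_of_conj := fun _ _ _ _ => rfl } } : BelyiCurveModel.{0}) :=
  cor_3_8_of_cuspOf_eq_id _ (fun _ => ⟨()⟩) fun _ _ => rfl

/-- **F-0267 at the same term** ([AbsTopII] Cor 3.7 as typed, `Cor_3_7 M`): at the split tripod-shaped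
model over `ℚ` the geometric fundamental group of the (identity) cuspidalization is `Δ ≅ F̂₂`, which is
slim (`isSlimGroup_profiniteCompletion_freeGroup 2`), so abc-iut-f-064's instance form
`cor_3_7_of_isSlimGroup_cuspOf_geom` ([AbsAnab] Lem 1.3.1 + "`G` slim") applies: `Cor_3_7` holds — with
the model's own `Π_{U_X} ↠ Π` as the Belyi cuspidalization of shape (a)(b)(c).  Identity cuspidalization:
the content of (a) is absent (see the module docstring). [cite: MochizukiAbsTopII2013, Cor 3.7 pp.72-73] -/
theorem cor_3_7_tripodIdModel :
    Literature.AnabelianGeometry.AbsoluteAnabelian.AbsTopII.BelyiCurveModel.Cor_3_7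
      ({ Curve := Unit
         ext := fun _ =>
           { arith := ProfiniteGrp.of (profiniteCompletion (FreeGroup (Fin 2)) × Field.absoluteGaloisGroup ℚ)
             gal := absoluteGaloisGrp ℚ
             aug := ContinuousMonoidHom.snd _ _
             aug_surjective := fun y => ⟨(1, y), rfl⟩ }
         FinEt := fun _ _ => Unit
         extMap := fun _ => 𝟙 _
         extMap_isOpenInjective := fun _ => FundamentalExtension.Hom.IsOpenInjective.id _
         IsScheme := fun _ => True
         genus := fun _ => 0
         cuspCard := fun _ => 3
         IsDefinedOverNF := fun _ => True
         base := fun _ => ℚ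
         instField := fun _ => inferInstance
         instCharZero := fun _ => inferInstance
         galIso := fun _ => Iso.refl _
         Open := fun _ => Unit
         cuspOf := fun _ => ⟨_, 𝟙 _, Function.surjective_id, Function.bijective_id⟩
         cuspsOf := fun _ =>
           { Cusp := Unit
             Dcusp := fun _ =>
               Subgroup.comap (MonoidHom.fst _ (Field.absoluteGaloisGroup ℚ))
                 (Subgroup.zpowers (toCompletion (FreeGroup (Fin 2)) (FreeGroup.of 0))).topologicalClosure
             Icusp := fun _ =>
               Subgroup.comap (MonoidHom.fst _ (Field.absoluteGaloisGroup ℚ))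
                   (Subgroup.zpowers
                     (toCompletion (FreeGroup (Fin 2)) (FreeGroup.of 0))).topologicalClosure ⊓
                 (ContinuousMonoidHom.snd (profiniteCompletion (FreeGroup (Fin 2)))
                   (Field.absoluteGaloisGroup ℚ)).toMonoidHom.ker
             Icusp_eq := fun _ => rfl
             isClosed_Dcusp := fun _ => (Subgroup.isClosed_topologicalClosure _).preimage continuous_fst
             eq_of_conj := fun _ _ _ _ => rfl } } : BelyiCurveModel.{0}) := by
  refine cor_3_7_of_isSlimGroup_cuspOf_geom _ fun X _ U => ?_
  -- `Δ_{U_X} = Δ = F̂₂ × 1 ≃ₜ* F̂₂`, which is slim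
  let e : profiniteCompletion (FreeGroup (Fin 2)) ≃ₜ*
      ↥(({ arith := ProfiniteGrp.of (profiniteCompletion (FreeGroup (Fin 2)) × Field.absoluteGaloisGroup ℚ)
           gal := absoluteGaloisGrp ℚ
           aug := ContinuousMonoidHom.snd _ _
           aug_surjective := fun y => ⟨(1, y), rfl⟩ } : FundamentalExtension.{0}).geom) :=
    { toFun := fun a => ⟨(a, 1), rfl⟩
      invFun := fun x => x.1.1
      left_inv := fun _ => rfl
      right_inv := fun x => by
        obtain ⟨⟨a, y⟩, hy⟩ := x
        have hy' : y = 1 := hy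
        subst hy'
        rfl
      map_mul' := fun _ _ => rfl
      continuous_toFun := (continuous_id.prodMk continuous_const).subtype_mk _
      continuous_invFun := continuous_fst.comp continuous_subtype_val }
  exact isSlimGroup_of_continuousMulEquiv e (isSlimGroup_profiniteCompletion_freeGroup 2 le_rfl)

end Literature.AnabelianGeometry.AbsoluteAnabelian.AbsTopII.BelyiCurveModel

end
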